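import Mathlib
import HarnessLib
import Summits.KontsevichZagierPeriods.KontsevichZagierPeriods.Theses.LinRedNormalForm
import Literature.NumberTheory.Transcendental.KZUnfolding

/-!
# Sketch — crux idea `cube-symmetry-moves` (crux stmt-KontsevichZagierPeriods-3912, `DihedralNormalForm`)

Ideator 4, round 2 (gen 2). First checkable statements of the line, over existing declarations only:
`Literature.NumberTheory.Transcendental.KZ.IntegralRep`, `KZ.of`, `KZ.changeOfVariablesRel`,
`KZ.integrandAddRel`, `KZ.permRel`, `KZ.relations`, `KZ.IntegralRep.reindex`.

Conventions (the crux's): the open ordered simplex is `{t : Fin k → ℝ | (∀ i, 0 < t i) ∧ (∀ i, t i < 1) ∧ StrictAnti t}`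
(`1 > t₀ > t₁ > ⋯ > t_{k-1} > 0`); CUBICAL coordinates `x ∈ (0,1)^k` are `x₀ = t₀`, `xᵢ = tᵢ / tᵢ₋₁`, i.e.
`tᵢ = x₀ x₁ ⋯ xᵢ` (Markarian, arXiv:2008.00855, proof of Prop. 2), with Jacobian `∏ⱼ xⱼ^(k-1-j) > 0`.
-/

namespace Summit.KontsevichZagierPeriods.KontsevichZagierPeriods.Cruxes.DihedralNormalForm.CubeSymmetryMoves

open Literature.NumberTheory.Transcendental Set
open scoped BigOperators

noncomputable section

/-- The crux's open ordered simplex `1 > t₀ > ⋯ > t_{k-1} > 0`. -/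
def simplex (k : ℕ) : Set (Fin k → ℝ) := {t | (∀ i, 0 < t i) ∧ (∀ i, t i < 1) ∧ StrictAnti t}

/-- The open unit cube. -/
def cube (k : ℕ) : Set (Fin k → ℝ) := {x | ∀ i, x i ∈ Ioo (0 : ℝ) 1}

/-- Cubical → simplicial coordinates: `tᵢ = x₀ x₁ ⋯ xᵢ` (a polynomial bijection `cube k → simplex k`). -/
def simplexOfCube (k : ℕ) (x : Fin k → ℝ) : Fin k → ℝ :=
  fun i => ∏ j : Fin k, if j ≤ i then x j else 1

/-- Simplicial → cubical coordinates: `x₀ = t₀`, `xᵢ = tᵢ / tᵢ₋₁` (rational inverse of `simplexOfCube` on the cell). -/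
def cubeOfSimplex (k : ℕ) (t : Fin k → ℝ) : Fin k → ℝ :=
  fun i => if h : (i : ℕ) = 0 then t i else t i / t ⟨(i : ℕ) - 1, by omega⟩

/-- The Jacobian monomial `∏ⱼ xⱼ^(k-1-j)` of `simplexOfCube`. -/
def jacMonomial (k : ℕ) (x : Fin k → ℝ) : ℝ := ∏ j : Fin k, x j ^ (k - 1 - (j : ℕ))

/-- FIRST LEMMA, part (a) — SIMPLEX ↔ CUBE IS ONE CHANGE OF VARIABLES (provable now): for a representation `r`
on the cube and `r'` on the simplex with `r.integrand x = r'.integrand (t(x)) · ∏ xⱼ^(k-1-j)`, the element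
`[r] − [r']` is a single `changeOfVariablesRel` instance (Φ = `simplexOfCube k`, polynomial hence
ℚ-semialgebraic, injective on the open cube with image the open simplex, `|det Φ'| = jacMonomial`). -/
def SimplexCubeMove : Prop :=
  ∀ (k : ℕ) (r r' : KZ.IntegralRep k),
    r.domain = cube k → r'.domain = simplex k →
    (∀ x ∈ r.domain, r.integrand x = r'.integrand (simplexOfCube k x) * jacMonomial k x) →
    KZ.of r - KZ.of r' ∈ KZ.changeOfVariablesRel

/-- FIRST LEMMA, part (b) — THE CUBE-SYMMETRY (CARTIER–MARKARIAN) MOVE ON THE CRUX'S OWN REPRESENTATIONS: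
conjugating a coordinate PERMUTATION of the cube by the simplex↔cube map is a chain of three rule-2 moves
between two representations on the SAME simplex, for ANY absolutely convergent integrand (the target integrand is
absolutely convergent because the cube permutation preserves `∫|·|`). In simplicial coordinates the map
`Ψ_σ = simplexOfCube ∘ (· ∘ σ) ∘ cubeOfSimplex` is birational (Markarian: "permutations of coordinates in cubical
coordinates, but in simplicial coordinates they are birational transformations"), NOT a dihedral symmetry of the
cell in general. The hypothesis says: the cube integrand of `r'` is the σ-permuted cube integrand of `r`,
`G_{r'}(x) = G_r(x ∘ σ)` where `G_r(x) = r.integrand (simplexOfCube x) * jacMonomial x`, written at `x = cubeOfSimplex t`.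
Provable now from `SimplexCubeMove` (twice) and `KZ.of_sub_of_reindex_mem_permRel`
(`KZUnfolding.lean`) / `KZ.of_sub_of_reindex_mem_relations` (`KZProductIdeal.lean`). -/
def CubeSymmetryMove : Prop :=
  ∀ (k : ℕ) (σ : Equiv.Perm (Fin k)) (r r' : KZ.IntegralRep k),
    r.domain = simplex k → r'.domain = simplex k →
    (∀ t ∈ r'.domain,
      r'.integrand t * jacMonomial k (cubeOfSimplex k t) =
        r.integrand (simplexOfCube k (cubeOfSimplex k t ∘ σ)) * jacMonomial k (cubeOfSimplex k t ∘ σ)) →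
    KZ.of r - KZ.of r' ∈ KZ.relations

/-! ### The line's strengthened top-weight normal form (the Transfer target C⁺)

Labels `Fin (k+2)`: `a < k` is the marked point `t_a`, `a = k` is the point `0`, `a = k+1` is the point `1`
(`∞` is dropped, as in a cell-form). A CELL-FORM integrand is `± 1 / ∏ (successive differences)` along a
linear arrangement `π` of the `k+2` finite labels (Brown–Carr–Schneps, arXiv:0910.0122, Def. 2.2); a
convergent LOGARITHMIC integrand on the cell is a ℚ-combination of these (BCS Thm 2.12) — exactly the
top-weight part `H^k(M^δ_{0,k+3})` of the crux's class; absolute convergence is part of `IntegralRep`. -/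

/-- Value of a finite label at `t`. -/
def cellVal (k : ℕ) (t : Fin k → ℝ) (a : Fin (k + 2)) : ℝ :=
  if h : (a : ℕ) < k then t ⟨a, h⟩ else if (a : ℕ) = k then 0 else 1

/-- The cell-form denominator of the linear arrangement `π` (position ↦ label): product of successive differences. -/
def cellDen (k : ℕ) (π : Equiv.Perm (Fin (k + 2))) (t : Fin k → ℝ) : ℝ :=
  ∏ i : Fin (k + 1), (cellVal k t (π i.succ) - cellVal k t (π (Fin.castSucc i)))

/-- The MZV word representations, exactly as in the crux (`q ∈ ℚ` inside the integrand). -/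
def wordReps : Set KZ.FormalRep :=
  {x | ∃ (w : ℕ) (ε : Fin w → Bool) (q : ℚ) (s : KZ.IntegralRep w),
    s.domain = {t | (∀ i, 0 < t i) ∧ (∀ i, t i < 1) ∧ StrictAnti t} ∧
    Set.EqOn s.integrand (fun t => (q : ℝ) * ∏ i, if ε i then 1 / (1 - t i) else 1 / t i) s.domain ∧
    x = KZ.of s}

/-- `C⁺` OF THE LINE — LOG FORMS NORMALISE BY RULES 2 AND 1b ALONE (conjecture `CSymNF`, all `k`; verified in
this session by exact linear algebra for `k ≤ 4`, i.e. `n ≤ 7`, with `k = 5, 6` running as kit jobs j009040 /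
j009042 at filing): every absolutely convergent representation on the ordered simplex whose integrand is a ℚ-combination of
cell-form integrands is congruent to a ℤ-combination of MZV word representations modulo the subgroup generated by
CHANGES OF VARIABLES and INTEGRAND ADDITIVITY only — no domain dissection, no Newton–Leibniz: the changes of
variables used are the dihedral symmetries of the cell and the cube-symmetry moves `CubeSymmetryMove`. -/
def LogFormSymmetryNF : Prop :=
  ∀ (k : ℕ) (r : KZ.IntegralRep k) (c : Equiv.Perm (Fin (k + 2)) → ℚ),
    r.domain = simplex k →
    Set.EqOn r.integrand (fun t => ∑ π : Equiv.Perm (Fin (k + 2)), (c π : ℝ) / cellDen k π t) r.domain →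
    ∃ m ∈ AddSubgroup.closure wordReps,
      KZ.of r - m ∈ AddSubgroup.closure (KZ.changeOfVariablesRel ∪ KZ.integrandAddRel)

/-- Convergent LOGARITHMIC genus-zero representations of any dimension (the class of `LogFormSymmetryNF`, as a set of
generators of `KZ.FormalRep`; it contains the word representations up to the rational factor). -/
def logReps : Set KZ.FormalRep :=
  {x | ∃ (k : ℕ) (c : Equiv.Perm (Fin (k + 2)) → ℚ) (s : KZ.IntegralRep k),
    s.domain = simplex k ∧
    Set.EqOn s.integrand (fun t => ∑ π : Equiv.Perm (Fin (k + 2)), (c π : ℝ) / cellDen k π t) s.domain ∧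
    x = KZ.of s}

/-- PRODUCT representations of two convergent logarithmic genus-zero representations of positive dimensions
(`KZ.IntegralRep.prod`, KZProduct.lean): the images of Brown's CUBICAL ('stuffle') product map, which is the identity
of the cube in cubical coordinates — ONE rule-2 move away from a representation on the big simplex, no domain
dissection (BCS arXiv:0910.0122 p. 13; Brown ENS 2009 §2.7). They reduce factorwise by induction on the dimension
(ideal property `KZ.mul_mem_relations_left/right`, named facts) and by the shuffle of word simplices. -/
def prodLogReps : Set KZ.FormalRep :=
  {x | ∃ (a b : ℕ) (s : KZ.IntegralRep a) (s' : KZ.IntegralRep b),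
    0 < a ∧ 0 < b ∧ KZ.of s ∈ logReps ∧ KZ.of s' ∈ logReps ∧ x = KZ.of (s.prod s')}

/-- `C⁺′` — the product-augmented symmetry normal form (the honest all-`k` candidate after the `k = 5` computation of
this session: at `n = 8` dihedral + cube-permutation relations + the 8 weight-5 words reach rank 143 of 144, and the
images of the cubical product map are expected to supply the last dimension): log forms normalise by rules 2 and 1b to
ℤ-combinations of MZV word representations AND cubical products of lower log representations. -/
def LogFormSymmetryProductNF : Prop :=
  ∀ (k : ℕ) (r : KZ.IntegralRep k) (c : Equiv.Perm (Fin (k + 2)) → ℚ),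
    r.domain = simplex k →
    Set.EqOn r.integrand (fun t => ∑ π : Equiv.Perm (Fin (k + 2)), (c π : ℝ) / cellDen k π t) r.domain →
    ∃ m ∈ AddSubgroup.closure (wordReps ∪ prodLogReps),
      KZ.of r - m ∈ AddSubgroup.closure (KZ.changeOfVariablesRel ∪ KZ.integrandAddRel)

/-- `NF₁₂⊗` — the same target, with DOMAIN ADDITIVITY (rule 1a) also allowed among the relations (still no
Newton–Leibniz): this admits the modular product-map relations of Brown–Carr–Schneps (shuffle-cell dissections of
`f⁻¹(X_r × X_s)`, BCS Prop 2.19 / Def 2.22). Certified for `k ≤ 4` by this session's computation and for `k = 5` by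
the independent computation of card cell-zeta-coinvariant-transfer (dihedral + product-map relations + one word span
`H^5(M^δ_{0,8})`), to which the cube-symmetry module adds an 83-dimensional relation supply. -/
def LogFormLevelNF : Prop :=
  ∀ (k : ℕ) (r : KZ.IntegralRep k) (c : Equiv.Perm (Fin (k + 2)) → ℚ),
    r.domain = simplex k →
    Set.EqOn r.integrand (fun t => ∑ π : Equiv.Perm (Fin (k + 2)), (c π : ℝ) / cellDen k π t) r.domain →
    ∃ m ∈ AddSubgroup.closure (wordReps ∪ prodLogReps),
      KZ.of r - m ∈ AddSubgroup.closure (KZ.changeOfVariablesRel ∪ KZ.integrandAddRel ∪ KZ.domainAddRel)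

/-- The ladder: `NF₂⊗ → NF₁₂⊗` (monotonicity of closures). -/
theorem levelNF_of_productNF (h : LogFormSymmetryProductNF) : LogFormLevelNF := by
  intro k r c hd hi
  obtain ⟨m, hm, hrel⟩ := h k r c hd hi
  exact ⟨m, hm, AddSubgroup.closure_mono Set.subset_union_left hrel⟩

/-- The pure version implies the product-augmented one (monotonicity of closures). -/
theorem productNF_of_symmetryNF (h : LogFormSymmetryNF) : LogFormSymmetryProductNF := by
  intro k r c hd hi
  obtain ⟨m, hm, hrel⟩ := h k r c hd hi
  exact ⟨m, AddSubgroup.closure_mono Set.subset_union_left hm, hrel⟩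

/-- The weaker form actually consumed by the crux's de Rham lines (`LogNF` of card dihedral-polynomial-primitives,
`CS(n)` of card cell-zeta-coinvariant-transfer, `(R2)` of card tame-bv-stokes): the same with the full `KZ.relations`. -/
def LogFormNF : Prop :=
  ∀ (k : ℕ) (r : KZ.IntegralRep k) (c : Equiv.Perm (Fin (k + 2)) → ℚ),
    r.domain = simplex k →
    Set.EqOn r.integrand (fun t => ∑ π : Equiv.Perm (Fin (k + 2)), (c π : ℝ) / cellDen k π t) r.domain →
    ∃ m ∈ AddSubgroup.closure wordReps, KZ.of r - m ∈ KZ.relations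

/-- Rule-2 and rule-1b instances are relations (bookkeeping). -/
theorem closure_cov_add_le_relations :
    AddSubgroup.closure (KZ.changeOfVariablesRel ∪ KZ.integrandAddRel) ≤ KZ.relations := by
  rw [AddSubgroup.closure_le]
  rintro c (hc | hc)
  · exact AddSubgroup.subset_closure (Or.inl (Or.inr hc))
  · exact AddSubgroup.subset_closure (Or.inl (Or.inl (Or.inr hc)))

/-- TRANSFER (checked): the symmetry normal form implies the top-weight normal form used by the de Rham lines. -/
theorem logFormNF_of_symmetryNF (h : LogFormSymmetryNF) : LogFormNF := by
  intro k r c hd hi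
  obtain ⟨m, hm, hrel⟩ := h k r c hd hi
  exact ⟨m, hm, closure_cov_add_le_relations hrel⟩

end

end Summit.KontsevichZagierPeriods.KontsevichZagierPeriods.Cruxes.DihedralNormalForm.CubeSymmetryMoves
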